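import Mathlib
import HarnessLib
import Literature.Analysis.FluidPDE.SelfSimilar
import Literature.Analysis.FluidPDE.LocalTypeI
import Literature.Analysis.FluidPDE.VectorCalculus
import Literature.Analysis.FluidPDE.AncientMildCompactness
import Literature.Analysis.FluidPDE.NSBoundedMildOseenClassical
import Literature.Analysis.UnboundedOperators.HeatKernel
import Summits.NavierStokesRegularity.NavierStokesRegularity.Theorems.LocalSineTubeDoorProfileAlignedWindowRigidityAncient
import Summits.NavierStokesRegularity.NavierStokesRegularity.Theorems.PoloidalWindowDoorPoloidalWindowRigidityFlat
import Summits.NavierStokesRegularity.NavierStokesRegularity.Theorems.PoloidalWindowDoorPoloidalWindowRigidityZoomOut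

/-!
# Route `PoloidalWindowDoor`, crux `PoloidalWindowRigidity` (K2, stmt-NavierStokesRegularity-19708) —
# CONFINED PROFILES OF THE TYPE-I CLASS ARE TRIVIAL (mechanism «zoom-out symmetry gain», second application)

Cell ns-regularity-ideate, seat ns-poloidal-K2-p2 (stub-worker; lands `--supports` the crux, `--as helper`).  For the
WHOLE route class `𝔓(C)` (Type-I rate, continuous on the open slab, unit-viscosity Oseen-mild between negative
times, divergence-free slices — no poloidality):

* `exists_zoomOut_limit` — THE ZOOM-OUT LIMIT AT BAD POINTS (reusable form of the compactness step of
  `…Periodic.tendsto_zero_of_periodic`): given times `t_k < 0` and points `x_k` with `√(−t_k)‖v(t_k, x_k)‖ ≥ ε`, the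
  recentred zooms `w_k(s,y) = c_k v(c_k² s, x_k + c_k y)`, `c_k = √(−t_k)` (in the class by `…ZoomOut.class_zoom`),
  converge along a subsequence — pointwise on the open slab and locally uniformly on every slice — to a profile `W`
  OF THE CLASS (rate, continuity, Oseen identity, divergence-free slices) with `‖W(−1, 0)‖ ≥ ε` (KNSS 2009 Lemma 6.1,
  tree `KNSS2009_lemma61_typeI_rate`; weak → classical divergence by slice analyticity);
* `tendsto_zero_of_slabConfined` — if the scale-invariant size is UNIFORMLY SMALL OFF A FIXED SLAB,
  `∀ ε > 0 ∃ R ∀ s < 0 ∀ x, R ≤ |⟪x − x₀, a⟫| → √(−s)‖v(s,x)‖ ≤ ε` (`a ≠ 0`), then `sup_x √(−t)‖v(t,x)‖ → 0` as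
  `t → −∞`: bad points lie in the slab, and in the zoom-out the slab shrinks to the plane `⟪y, a⟫ = 0`, off which
  the limit `W` vanishes — hence everywhere, by continuity; contradiction;
* `eq_zero_of_slabConfined` / `nonflatLiouville_of_slabConfined` — so such a profile is `≡ 0`
  (`…ZoomOut.eq_zero_of_tendsto_zero`: backward ε-regularity + analyticity); `eq_zero_of_ballConfined` — the same
  for confinement to a fixed ball (`R ≤ ‖x − x₀‖ → small`), a fortiori (a tube around a fixed line is the slab case
  for any normal `a ⟂` the line).

Reading: an ancient Type-I profile carries no FIXED length scale — backward in time it cannot stay (in scale-invariant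
size) inside a slab, tube or ball of fixed width; the residue of K2 may assume the profile is confined near no plane.
(The space–time Type-I ENVELOPE `|v| ≤ C/(|x| + √(−t))` is NOT such a confinement: it is small only where
`|x| ≫ √(−t)`, a region that recedes under zoom-out — no claim there.)

WHAT THIS IS NOT: not a claim about Navier–Stokes regularity and not the open residue — settled strata, whole Type-I
class (bears_on LADDER-NS N0, rung N0-LocalTubeDoorPoloidal).
-/

noncomputable section

-- the summit and its single sub-problem share the name (CONVENTIONS §1), as in every Theorems file
set_option linter.dupNamespace false

namespace Summit.NavierStokesRegularity.NavierStokesRegularity.Theorems.PoloidalWindowDoorPoloidalWindowRigidityConfined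

open MeasureTheory Set Function Filter Topology TopologicalSpace Metric
open scoped RealInnerProductSpace InnerProductSpace
open Literature.Analysis Literature.Analysis.FluidPDE
open Summit.NavierStokesRegularity.NavierStokesRegularity.Theorems.LocalSineTubeDoorProfileAlignedWindowRigidityAncient
open Summit.NavierStokesRegularity.NavierStokesRegularity.Theorems.PoloidalWindowDoorPoloidalWindowRigidityZoomOut

variable {C : ℝ} {v : ℝ → EuclideanSpace ℝ (Fin 3) → EuclideanSpace ℝ (Fin 3)}

/-! ### the zoom-out limit at bad points -/

/-- **The zoom-out limit at bad points.** Let `v` be a profile of the class, and let `t_k < 0`, `x_k` be times and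
points with `ε ≤ √(−t_k)‖v(t_k, x_k)‖`.  Then the recentred zooms `w_k(s,y) = c_k v(c_k² s, x_k + c_k y)`,
`c_k = √(−t_k)`, converge along a subsequence `φ` — pointwise on the open slab, locally uniformly on every slice —
to a profile `W` of the class with `ε ≤ ‖W(−1, 0)‖`. -/
theorem exists_zoomOut_limit (hrate : HasTypeITimeDecay C v)
    (hcont : ContinuousOn (uncurry v) (Iio (0 : ℝ) ×ˢ univ))
    (hmild : ∀ s t : ℝ, s < t → t < 0 → ∀ x,
      v t x = UnboundedOperators.heatExtension (v s) (t - s) x - oseenDuhamel 1 s v v t x)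
    (hdiv : ∀ t < 0, VectorCalculus.IsDivFree (v t)) {ε : ℝ} {tk : ℕ → ℝ}
    {xk : ℕ → EuclideanSpace ℝ (Fin 3)} (htk : ∀ k, tk k < 0)
    (hbad : ∀ k, ε ≤ Real.sqrt (-tk k) * ‖v (tk k) (xk k)‖) :
    ∃ (φ : ℕ → ℕ) (W : ℝ → EuclideanSpace ℝ (Fin 3) → EuclideanSpace ℝ (Fin 3)), StrictMono φ ∧
      HasTypeITimeDecay C W ∧ ContinuousOn (uncurry W) (Iio (0 : ℝ) ×ˢ univ) ∧
      (∀ s t : ℝ, s < t → t < 0 → ∀ x,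
        W t x = UnboundedOperators.heatExtension (W s) (t - s) x - oseenDuhamel 1 s W W t x) ∧
      (∀ t < 0, VectorCalculus.IsDivFree (W t)) ∧
      ε ≤ ‖W (-1) 0‖ ∧
      (∀ s < 0, ∀ y, Tendsto (fun j => Real.sqrt (-tk (φ j)) •
          v (Real.sqrt (-tk (φ j)) ^ 2 * s) (xk (φ j) + Real.sqrt (-tk (φ j)) • y)) atTop (𝓝 (W s y))) ∧
      (∀ s < 0, TendstoLocallyUniformly (fun j y => Real.sqrt (-tk (φ j)) •
          v (Real.sqrt (-tk (φ j)) ^ 2 * s) (xk (φ j) + Real.sqrt (-tk (φ j)) • y)) (W s) atTop) := by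
  -- zoom factors
  set c : ℕ → ℝ := fun k => Real.sqrt (-tk k) with hcdef
  have hc0 : ∀ k, 0 < c k := fun k => Real.sqrt_pos.2 (neg_pos.2 (htk k))
  have hc2 : ∀ k, c k ^ 2 = -tk k := fun k => Real.sq_sqrt (neg_pos.2 (htk k)).le
  -- the zoomed fields and their class data
  set w : ℕ → ℝ → EuclideanSpace ℝ (Fin 3) → EuclideanSpace ℝ (Fin 3) :=
    fun k s y => c k • v (c k ^ 2 * s) (xk k + c k • y) with hwdef
  have hw : ∀ k, HasTypeITimeDecay C (w k) ∧ ContinuousOn (uncurry (w k)) (Iio (0 : ℝ) ×ˢ univ) ∧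
      (∀ s t : ℝ, s < t → t < 0 → ∀ x, w k t x =
        UnboundedOperators.heatExtension (w k s) (t - s) x - oseenDuhamel 1 s (w k) (w k) t x) ∧
      (∀ t < 0, VectorCalculus.IsDivFree (w k t)) := fun k =>
    class_zoom hrate hcont hmild hdiv (hc0 k) (xk k)
  -- compactness (KNSS Lemma 6.1, Type-I-rate form) on the windows `(−(k+1), 0)`
  have hA : Tendsto (fun k : ℕ => -((k : ℝ) + 1)) atTop atBot :=
    tendsto_neg_atTop_atBot.comp (tendsto_natCast_atTop_atTop.atTop_add tendsto_const_nhds)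
  have hcontk : ∀ k : ℕ, ContinuousOn (uncurry (w k)) (Ioo (-((k : ℝ) + 1)) 0 ×ˢ univ) := fun k =>
    (hw k).2.1.mono (prod_mono Ioo_subset_Iio_self Subset.rfl)
  have hdivk : ∀ k : ℕ, ∀ t ∈ Ioo (-((k : ℝ) + 1)) (0 : ℝ), IsWeaklyDivFree (w k t) := by
    intro k t ht
    have hC1 : ContDiff ℝ 1 (w k t) :=
      (analyticOnNhd_slice (hw k).2.1 (bdd_of_hasTypeITimeDecay (hw k).1) (hw k).2.2.1 ht.2).contDiff
    exact VectorCalculus.IsDivFree.isWeaklyDivFree_holds ((hw k).2.2.2 t ht.2) hC1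
  have hmildk : ∀ k : ℕ, ∀ s t : ℝ, -((k : ℝ) + 1) < s → s < t → t < 0 → ∀ x, w k t x =
      UnboundedOperators.heatExtension (w k s) (t - s) x - oseenDuhamel 1 s (w k) (w k) t x :=
    fun k s t _ hst ht x => (hw k).2.2.1 s t hst ht x
  have hIk : ∀ k : ℕ, ∀ τ ∈ Ioo (-((k : ℝ) + 1)) (0 : ℝ), ∀ x, Real.sqrt (-τ) * ‖w k τ x‖ ≤ C := by
    intro k τ hτ x
    have h := (hw k).1 τ hτ.2 x
    have hs : 0 < Real.sqrt (-τ) := Real.sqrt_pos.2 (neg_pos.2 hτ.2)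
    rw [mul_comm, ← le_div_iff₀ hs]
    exact h
  obtain ⟨φ, W, hφ, hWc, hWdiv, hWI, hWmild, -, hpt, hloc⟩ :=
    KNSS2009_lemma61_typeI_rate hA hcontk hdivk hmildk hIk
  -- class data of the limit
  have hWrate : HasTypeITimeDecay C W := fun t ht x => by
    have hs : 0 < Real.sqrt (-t) := Real.sqrt_pos.2 (neg_pos.2 ht)
    rw [le_div_iff₀ hs, mul_comm]
    exact hWI t ht x
  have hWbdd := bdd_of_hasTypeITimeDecay hWrate
  have hWdiv' : ∀ t < 0, VectorCalculus.IsDivFree (W t) := fun t ht =>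
    IsWeaklyDivFree.isDivFree_of_contDiff (analyticOnNhd_slice hWc hWbdd hWmild ht).contDiff (hWdiv t ht)
  -- the limit is not small at `(−1, 0)`
  have hbig : ∀ j, ε ≤ ‖w (φ j) (-1) 0‖ := by
    intro j
    have e : w (φ j) (-1) 0 = c (φ j) • v (tk (φ j)) (xk (φ j)) := by
      simp only [hwdef, mul_neg_one, hc2, neg_neg, smul_zero, add_zero]
    rw [e, norm_smul, Real.norm_of_nonneg (hc0 _).le]
    exact hbad (φ j)
  have hnorm : ε ≤ ‖W (-1) 0‖ :=
    ge_of_tendsto ((hpt (-1) (by norm_num) 0).norm) (Eventually.of_forall hbig)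
  exact ⟨φ, W, hφ, hWrate, hWc, hWmild, hWdiv', hnorm, hpt, hloc⟩

/-! ### confinement to a slab -/

/-- **Slab-confined profiles are small at `−∞`.** If the scale-invariant size of a profile of the class is uniformly
small off the fixed slabs around the plane `⟪x − x₀, a⟫ = 0` (`a ≠ 0`) — for every `ε > 0` there is `R` with
`√(−s)‖v(s,x)‖ ≤ ε` whenever `R ≤ |⟪x − x₀, a⟫|`, for ALL `s < 0` — then `sup_x √(−t)‖v(t,x)‖ → 0` as `t → −∞`. -/
theorem tendsto_zero_of_slabConfined (hrate : HasTypeITimeDecay C v)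
    (hcont : ContinuousOn (uncurry v) (Iio (0 : ℝ) ×ˢ univ))
    (hmild : ∀ s t : ℝ, s < t → t < 0 → ∀ x,
      v t x = UnboundedOperators.heatExtension (v s) (t - s) x - oseenDuhamel 1 s v v t x)
    (hdiv : ∀ t < 0, VectorCalculus.IsDivFree (v t)) {a : EuclideanSpace ℝ (Fin 3)} (ha : a ≠ 0)
    (x₀ : EuclideanSpace ℝ (Fin 3))
    (hconf : ∀ ε : ℝ, 0 < ε → ∃ R : ℝ, ∀ s < 0, ∀ x, R ≤ |⟪x - x₀, a⟫_ℝ| → Real.sqrt (-s) * ‖v s x‖ ≤ ε) :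
    ∀ ε : ℝ, 0 < ε → ∃ T : ℝ, T < 0 ∧ ∀ t < T, ∀ x, Real.sqrt (-t) * ‖v t x‖ ≤ ε := by
  intro ε hε
  by_contra hcon
  push Not at hcon
  -- a bad sequence `t_k < −(k+1)`, `x_k`
  have hch : ∀ k : ℕ, ∃ t : ℝ, t < -((k : ℝ) + 1) ∧ ∃ x, ε < Real.sqrt (-t) * ‖v t x‖ := fun k =>
    hcon _ (by have : (0 : ℝ) ≤ k := Nat.cast_nonneg k; linarith)
  choose tk htk xk hxk using hch
  have htk0 : ∀ k, tk k < 0 := fun k => by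
    have := htk k; have : (0 : ℝ) ≤ k := Nat.cast_nonneg k; linarith
  -- the bad points lie in the slab of half-width `R(ε)`
  obtain ⟨R₁, hR₁⟩ := hconf ε hε
  have hslab : ∀ k, |⟪xk k - x₀, a⟫_ℝ| < R₁ := fun k => by
    by_contra hge
    push Not at hge
    exact absurd (hR₁ (tk k) (htk0 k) (xk k) hge) (not_le.2 (hxk k))
  -- zoom factors `c_k = √(−t_k) → ∞`
  set c : ℕ → ℝ := fun k => Real.sqrt (-tk k) with hcdef
  have hc0 : ∀ k, 0 < c k := fun k => Real.sqrt_pos.2 (neg_pos.2 (htk0 k))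
  have hcinf : Tendsto c atTop atTop := by
    have h1 : Tendsto (fun k : ℕ => Real.sqrt ((k : ℝ) + 1)) atTop atTop :=
      Real.tendsto_sqrt_atTop.comp (tendsto_natCast_atTop_atTop.atTop_add tendsto_const_nhds)
    refine tendsto_atTop_mono (fun k => ?_) h1
    exact Real.sqrt_le_sqrt (by have := htk k; linarith)
  -- the zoom-out limit
  obtain ⟨φ, W, hφ, hWrate, hWc, hWmild, -, hnorm, hpt, -⟩ :=
    exists_zoomOut_limit hrate hcont hmild hdiv htk0 fun k => (hxk k).le
  -- the limit vanishes off the plane `⟪y, a⟫ = 0`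
  have hoff : ∀ s < 0, ∀ y, ⟪y, a⟫_ℝ ≠ 0 → W s y = 0 := by
    intro s hs y hy
    have hsq : 0 < Real.sqrt (-s) := Real.sqrt_pos.2 (neg_pos.2 hs)
    -- `√(−s)‖W(s,y)‖ ≤ δ` for every `δ > 0`
    have hsmall : ∀ δ : ℝ, 0 < δ → Real.sqrt (-s) * ‖W s y‖ ≤ δ := by
      intro δ hδ
      obtain ⟨R, hR⟩ := hconf δ hδ
      -- eventually the zoomed points `x_k + c_k y` leave the slab of half-width `R`
      have hfar : ∀ᶠ j in atTop, R ≤ |⟪xk (φ j) + c (φ j) • y - x₀, a⟫_ℝ| := by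
        have hcj : Tendsto (fun j => c (φ j)) atTop atTop := hcinf.comp hφ.tendsto_atTop
        have hev : ∀ᶠ j in atTop, (R + R₁) / |⟪y, a⟫_ℝ| ≤ c (φ j) := hcj.eventually (eventually_ge_atTop _)
        filter_upwards [hev] with j hj
        have hya : 0 < |⟪y, a⟫_ℝ| := abs_pos.2 hy
        have h1 : R + R₁ ≤ c (φ j) * |⟪y, a⟫_ℝ| := by rwa [div_le_iff₀ hya] at hj
        have e : ⟪xk (φ j) + c (φ j) • y - x₀, a⟫_ℝ = ⟪xk (φ j) - x₀, a⟫_ℝ + c (φ j) * ⟪y, a⟫_ℝ := by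
          rw [show xk (φ j) + c (φ j) • y - x₀ = (xk (φ j) - x₀) + c (φ j) • y by abel, inner_add_left,
            inner_smul_left]
          simp
        rw [e]
        have h2 : |c (φ j) * ⟪y, a⟫_ℝ| = c (φ j) * |⟪y, a⟫_ℝ| := by
          rw [abs_mul, abs_of_pos (hc0 _)]
        have h3 := abs_sub_abs_le_abs_sub (c (φ j) * ⟪y, a⟫_ℝ) (-(⟪xk (φ j) - x₀, a⟫_ℝ))
        rw [sub_neg_eq_add, abs_neg, h2, add_comm (c (φ j) * ⟪y, a⟫_ℝ)] at h3
        have h4 := hslab (φ j)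
        linarith
      -- along the subsequence, `√(−s)‖w_j(s,y)‖ ≤ δ`
      have hle : ∀ᶠ j in atTop, Real.sqrt (-s) * ‖c (φ j) • v (c (φ j) ^ 2 * s) (xk (φ j) + c (φ j) • y)‖ ≤ δ := by
        filter_upwards [hfar] with j hj
        have hσ : c (φ j) ^ 2 * s < 0 := mul_neg_of_pos_of_neg (pow_pos (hc0 _) 2) hs
        have h := hR (c (φ j) ^ 2 * s) hσ (xk (φ j) + c (φ j) • y) hj
        have hsqσ : Real.sqrt (-(c (φ j) ^ 2 * s)) = c (φ j) * Real.sqrt (-s) := by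
          rw [show -(c (φ j) ^ 2 * s) = c (φ j) ^ 2 * (-s) by ring, Real.sqrt_mul (sq_nonneg _),
            Real.sqrt_sq (hc0 _).le]
        rw [hsqσ] at h
        rw [norm_smul, Real.norm_of_nonneg (hc0 _).le]
        calc Real.sqrt (-s) * (c (φ j) * ‖v (c (φ j) ^ 2 * s) (xk (φ j) + c (φ j) • y)‖)
            = c (φ j) * Real.sqrt (-s) * ‖v (c (φ j) ^ 2 * s) (xk (φ j) + c (φ j) • y)‖ := by ring
          _ ≤ δ := h
      exact le_of_tendsto (((hpt s hs y).norm).const_mul (Real.sqrt (-s))) hle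
    have hz : Real.sqrt (-s) * ‖W s y‖ ≤ 0 := by
      by_contra hpos
      push Not at hpos
      have h := hsmall (Real.sqrt (-s) * ‖W s y‖ / 2) (by positivity)
      linarith
    have hn : ‖W s y‖ ≤ 0 := by
      by_contra hne
      push Not at hne
      have : 0 < Real.sqrt (-s) * ‖W s y‖ := mul_pos hsq hne
      linarith
    exact norm_le_zero_iff.1 hn
  -- hence everywhere, by continuity (approach a point of the plane along `a`)
  have hall : ∀ s < 0, ∀ y, W s y = 0 := by
    intro s hs y
    by_cases hy : ⟪y, a⟫_ℝ ≠ 0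
    · exact hoff s hs y hy
    · push Not at hy
      have ha2 : 0 < ⟪a, a⟫_ℝ := real_inner_self_pos.2 ha
      -- `y_n = y + (n+1)⁻¹ a → y`, off the plane
      have hseq : Tendsto (fun n : ℕ => y + ((n : ℝ) + 1)⁻¹ • a) atTop (𝓝 y) := by
        have h1 : Tendsto (fun n : ℕ => ((n : ℝ) + 1)⁻¹) atTop (𝓝 0) :=
          tendsto_inv_atTop_zero.comp (tendsto_natCast_atTop_atTop.atTop_add tendsto_const_nhds)
        simpa using tendsto_const_nhds.add (h1.smul_const a)
      have hvals : ∀ n : ℕ, W s (y + ((n : ℝ) + 1)⁻¹ • a) = 0 := fun n => by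
        refine hoff s hs _ ?_
        rw [inner_add_left, inner_smul_left, hy, zero_add]
        simp only [conj_trivial]
        exact mul_ne_zero (inv_ne_zero (by positivity)) ha2.ne'
      have hlim : Tendsto (fun n : ℕ => W s (y + ((n : ℝ) + 1)⁻¹ • a)) atTop (𝓝 (W s y)) :=
        ((continuous_slice hWc hs).tendsto y).comp hseq
      have hlim0 : Tendsto (fun n : ℕ => W s (y + ((n : ℝ) + 1)⁻¹ • a)) atTop (𝓝 0) := by
        simp only [hvals]; exact tendsto_const_nhds
      exact tendsto_nhds_unique hlim hlim0
  have h0 : W (-1) 0 = 0 := hall (-1) (by norm_num) 0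
  rw [h0, norm_zero] at hnorm
  linarith

/-- **SLAB-CONFINED PROFILES ARE TRIVIAL.** A profile of the route's Type-I class whose scale-invariant size is
uniformly small off the fixed slabs around a plane (`a ≠ 0`, `x₀`: for every `ε > 0` some `R` with
`√(−s)‖v(s,x)‖ ≤ ε` whenever `R ≤ |⟪x − x₀, a⟫|`, all `s < 0`) vanishes identically. -/
theorem eq_zero_of_slabConfined (hrate : HasTypeITimeDecay C v)
    (hcont : ContinuousOn (uncurry v) (Iio (0 : ℝ) ×ˢ univ))
    (hmild : ∀ s t : ℝ, s < t → t < 0 → ∀ x,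
      v t x = UnboundedOperators.heatExtension (v s) (t - s) x - oseenDuhamel 1 s v v t x)
    (hdiv : ∀ t < 0, VectorCalculus.IsDivFree (v t)) {a : EuclideanSpace ℝ (Fin 3)} (ha : a ≠ 0)
    (x₀ : EuclideanSpace ℝ (Fin 3))
    (hconf : ∀ ε : ℝ, 0 < ε → ∃ R : ℝ, ∀ s < 0, ∀ x, R ≤ |⟪x - x₀, a⟫_ℝ| → Real.sqrt (-s) * ‖v s x‖ ≤ ε) :
    ∀ t < 0, ∀ x, v t x = 0 :=
  eq_zero_of_tendsto_zero hrate hcont hmild (tendsto_zero_of_slabConfined hrate hcont hmild hdiv ha x₀ hconf)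

/-- Slab-confined profiles: not backward-singular. -/
theorem nonflatLiouville_of_slabConfined (hrate : HasTypeITimeDecay C v)
    (hcont : ContinuousOn (uncurry v) (Iio (0 : ℝ) ×ˢ univ))
    (hmild : ∀ s t : ℝ, s < t → t < 0 → ∀ x,
      v t x = UnboundedOperators.heatExtension (v s) (t - s) x - oseenDuhamel 1 s v v t x)
    (hdiv : ∀ t < 0, VectorCalculus.IsDivFree (v t)) {a : EuclideanSpace ℝ (Fin 3)} (ha : a ≠ 0)
    (x₀ : EuclideanSpace ℝ (Fin 3))
    (hconf : ∀ ε : ℝ, 0 < ε → ∃ R : ℝ, ∀ s < 0, ∀ x, R ≤ |⟪x - x₀, a⟫_ℝ| → Real.sqrt (-s) * ‖v s x‖ ≤ ε) :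
    ¬ IsBackwardSingularPoint v 0 :=
  Summit.NavierStokesRegularity.NavierStokesRegularity.Theorems.PoloidalWindowDoorPoloidalWindowRigidityFlat.not_backwardSingular_of_zero
    (eq_zero_of_slabConfined hrate hcont hmild hdiv ha x₀ hconf)

/-- **BALL-CONFINED PROFILES ARE TRIVIAL** (a fortiori: outside the slab `|⟪x − x₀, e₀⟫| ≥ R` one is outside the
ball `‖x − x₀‖ < R`). -/
theorem eq_zero_of_ballConfined (hrate : HasTypeITimeDecay C v)
    (hcont : ContinuousOn (uncurry v) (Iio (0 : ℝ) ×ˢ univ))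
    (hmild : ∀ s t : ℝ, s < t → t < 0 → ∀ x,
      v t x = UnboundedOperators.heatExtension (v s) (t - s) x - oseenDuhamel 1 s v v t x)
    (hdiv : ∀ t < 0, VectorCalculus.IsDivFree (v t)) (x₀ : EuclideanSpace ℝ (Fin 3))
    (hconf : ∀ ε : ℝ, 0 < ε → ∃ R : ℝ, ∀ s < 0, ∀ x, R ≤ ‖x - x₀‖ → Real.sqrt (-s) * ‖v s x‖ ≤ ε) :
    ∀ t < 0, ∀ x, v t x = 0 := by
  -- the unit normal `e₀`
  set e : EuclideanSpace ℝ (Fin 3) := EuclideanSpace.single 0 (1 : ℝ) with he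
  have he1 : ‖e‖ = 1 := by rw [he, EuclideanSpace.single, PiLp.norm_single, norm_one]
  have hne : e ≠ 0 := fun h0 => by rw [h0, norm_zero] at he1; exact zero_ne_one he1
  refine eq_zero_of_slabConfined hrate hcont hmild hdiv hne x₀ fun ε hε => ?_
  obtain ⟨R, hR⟩ := hconf ε hε
  refine ⟨R, fun s hs x hx => hR s hs x (hx.trans ?_)⟩
  calc |⟪x - x₀, e⟫_ℝ| ≤ ‖x - x₀‖ * ‖e‖ := abs_real_inner_le_norm _ _
    _ = ‖x - x₀‖ := by rw [he1, mul_one]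

end Summit.NavierStokesRegularity.NavierStokesRegularity.Theorems.PoloidalWindowDoorPoloidalWindowRigidityConfined

end
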